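import Mathlib
import Summits.ValiantsHypothesis.ValiantsHypothesis.Theorems.NewtonUnitEquationsDissociatedUniformTotalsLaw
import Summits.ValiantsHypothesis.ValiantsHypothesis.Theorems.NewtonUnitEquationsDissociatedUniformTotalsLawRankOne
import Summits.ValiantsHypothesis.ValiantsHypothesis.Theorems.NewtonUnitEquationsDissociatedUniformTotalsLawRankOneCex
import Literature.Computability.AlgebraicComplexity.NewtonPolygonTauProductBounds
import HarnessLib

/-!
# Crux `NewtonUnitEquations.DissociatedUniform` (stmt-ValiantsHypothesis-5905), `n = 3` totals law of model (Q**):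
# the envelope problem — ADMISSIBILITY of pieces (fibre exchange): a piece's row is better than every row whose
# diagonal partner column is no worse, and symmetrically

Companion of `…TotalsLawRankOne` (`envPt`, `envPts`, `IsSWExposed`, `@[conjecture] EnvelopeBound C`) and `…TotalsLawRankOneCex`
(`ecost`, `dot_envPt`).  Memo `Cruxes/DissociatedUniform/NOTES-t1g19.md` §4(vii)/§5.  The first structural constraint on the pieces of
the envelope of the lines `τ φ x + (1-τ) ψ y + c (x+y)`: compare the cell `(x, y)` with the cell `(x', y + (x - x'))` on the SAME
anti-diagonal (same `c`).  If `(x, y)` is the strict minimiser at a parameter `τ`: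
* `psi_lt_of_piece` (`τ > 0`): for every row `x'` with `φ x' < φ x`, the column `y + (x - x')` is strictly worse: `ψ y < ψ (y + (x - x'))`;
* `phi_lt_of_piece` (`τ < 1`): for every column `y'` with `ψ y' < ψ y`, the row `x + (y - y')` is strictly worse: `φ x < φ (x + (y - y'))`;
* `phi_le_of_piece_one` / `psi_le_of_piece_zero`: at `τ = 1` the piece's row minimises `φ`, at `τ = 0` its column minimises `ψ`.
Consequently (memo §4(vii)) a piece at `τ ∈ (0,1)` has `rank_φ(x) + rank_ψ(y) ≤ |G| - 1` (the map `y' ↦ x + y - y'` sends the columns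
better than `y` injectively into the rows worse than `x`): cells whose row and column are both bad never appear.  This halves the trivial
bound but is far from `EnvelopeBound`; it is recorded as the exchange step every sharper argument starts from.
Honest label: elementary structure; `EnvelopeBound`, `RankOnePointwise`, `TotalsLawThree` remain OPEN; VP ≠ VNP is not touched.
[folklore: exchange argument]
-/

set_option linter.dupNamespace false -- `ValiantsHypothesis.ValiantsHypothesis` (summit = problem) in every name

open Matrix Finset

namespace Summit.ValiantsHypothesis.ValiantsHypothesis.Theorems.NewtonUnitEquationsDissociatedUniform

namespace TotalsLaw

open Literature.Computability.AlgebraicComplexity.KPTT.PlanarMinkowski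

section Admissible

variable {G : Type*} [AddCommGroup G] [Fintype G]
variable {φ ψ c : G → ℝ} {x y : G} {τ : ℝ}

/-- Membership of every cell's point in `envPts`. [folklore] -/
theorem envPt_mem_envPts (φ ψ c : G → ℝ) (q : G × G) : envPt φ ψ c q ∈ envPts φ ψ c := by
  classical
  unfold envPts
  exact Finset.mem_image.2 ⟨q, Finset.mem_univ _, rfl⟩

/-- The cost comparison delivered by a strict top: every cell with a DIFFERENT point costs strictly more. [folklore] -/
theorem ecost_lt_of_isStrictTop (h : IsStrictTop ![-(1 - τ), -τ] (envPts φ ψ c) (envPt φ ψ c (x, y))) {q : G × G}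
    (hne : envPt φ ψ c q ≠ envPt φ ψ c (x, y)) : ecost φ ψ c τ (x, y) < ecost φ ψ c τ q := by
  have hlt := h.2 _ (envPt_mem_envPts φ ψ c q) hne
  rw [dot_envPt, dot_envPt] at hlt
  linarith

/-- **Admissibility, row form.**  If the cell `(x, y)` is the strict minimiser at a parameter `τ > 0`, then for every row `x'`
with `φ x' < φ x` the diagonal partner column `y + (x - x')` (so that `x' + (y + (x - x')) = x + y`) is strictly worse than `y`.
[folklore] -/
theorem psi_lt_of_piece (hτ : 0 < τ) (hτ1 : τ ≤ 1)
    (h : IsStrictTop ![-(1 - τ), -τ] (envPts φ ψ c) (envPt φ ψ c (x, y))) {x' : G} (hx' : φ x' < φ x) :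
    ψ y < ψ (y + (x - x')) := by
  set y' := y + (x - x') with hy'
  have hsum : x' + y' = x + y := by rw [hy']; abel
  by_contra hle
  rw [not_lt] at hle
  -- the two points differ (second coordinates differ since `φ x' < φ x` and the `c`-terms agree)
  have hne : envPt φ ψ c (x', y') ≠ envPt φ ψ c (x, y) := by
    intro heq
    have h1 := congrFun heq 1
    simp only [envPt, cons_val_one, cons_val_zero] at h1
    rw [hsum] at h1
    linarith
  have hlt := ecost_lt_of_isStrictTop h hne
  simp only [ecost, hsum] at hlt
  have h1τ : 0 ≤ 1 - τ := by linarith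
  nlinarith [mul_le_mul_of_nonneg_left hle h1τ, mul_lt_mul_of_pos_left hx' hτ]

/-- **Admissibility, column form.**  If `(x, y)` is the strict minimiser at a parameter `τ < 1`, then for every column `y'` with
`ψ y' < ψ y` the diagonal partner row `x + (y - y')` is strictly worse than `x`. [folklore] -/
theorem phi_lt_of_piece (hτ : 0 ≤ τ) (hτ1 : τ < 1)
    (h : IsStrictTop ![-(1 - τ), -τ] (envPts φ ψ c) (envPt φ ψ c (x, y))) {y' : G} (hy' : ψ y' < ψ y) :
    φ x < φ (x + (y - y')) := by
  set x' := x + (y - y') with hx'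
  have hsum : x' + y' = x + y := by rw [hx']; abel
  by_contra hle
  rw [not_lt] at hle
  have hne : envPt φ ψ c (x', y') ≠ envPt φ ψ c (x, y) := by
    intro heq
    have h0 := congrFun heq 0
    simp only [envPt, cons_val_zero] at h0
    rw [hsum] at h0
    linarith
  have hlt := ecost_lt_of_isStrictTop h hne
  simp only [ecost, hsum] at hlt
  have h1τ : 0 < 1 - τ := by linarith
  nlinarith [mul_le_mul_of_nonneg_left hle hτ, mul_lt_mul_of_pos_left hy' h1τ]

/-- At `τ = 1` the piece's row minimises `φ` (no strictly better row exists). [folklore] -/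
theorem phi_le_of_piece_one (h : IsStrictTop ![-(1 - (1 : ℝ)), -1] (envPts φ ψ c) (envPt φ ψ c (x, y))) (x' : G) :
    φ x ≤ φ x' := by
  by_contra hlt
  rw [not_le] at hlt
  have h1 := psi_lt_of_piece (τ := 1) one_pos le_rfl h hlt
  -- at `τ = 1` the same exchange gives a contradiction outright: redo the cost comparison
  set y' := y + (x - x') with hy'
  have hsum : x' + y' = x + y := by rw [hy']; abel
  have hne : envPt φ ψ c (x', y') ≠ envPt φ ψ c (x, y) := by
    intro heq
    have h1' := congrFun heq 1
    simp only [envPt, cons_val_one, cons_val_zero] at h1'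
    rw [hsum] at h1'
    linarith
  have hc := ecost_lt_of_isStrictTop h hne
  simp only [ecost, hsum] at hc
  linarith

/-- At `τ = 0` the piece's column minimises `ψ`. [folklore] -/
theorem psi_le_of_piece_zero (h : IsStrictTop ![-(1 - (0 : ℝ)), -0] (envPts φ ψ c) (envPt φ ψ c (x, y))) (y' : G) :
    ψ y ≤ ψ y' := by
  by_contra hlt
  rw [not_le] at hlt
  set x' := x + (y - y') with hx'
  have hsum : x' + y' = x + y := by rw [hx']; abel
  have hne : envPt φ ψ c (x', y') ≠ envPt φ ψ c (x, y) := by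
    intro heq
    have h0 := congrFun heq 0
    simp only [envPt, cons_val_zero] at h0
    rw [hsum] at h0
    linarith
  have hc := ecost_lt_of_isStrictTop h hne
  simp only [ecost, hsum] at hc
  linarith

end Admissible

/-! ### APPENDED (same seat): the rank consequence `rank_φ(x) + rank_ψ(y) + 1 ≤ |G|` -/

section Rank

variable {G : Type*} [AddCommGroup G] [Fintype G] [DecidableEq G]
variable {φ ψ c : G → ℝ} {x y : G} {τ : ℝ}

/-- **Rank bound.**  If `(x, y)` is the strict minimiser at a parameter `τ ∈ (0,1)`, then
`#{x' : φ x' < φ x} + #{y' : ψ y' < ψ y} + 1 ≤ |G|`: the columns better than `y` are sent by `y' ↦ x + (y - y')` injectively into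
the rows strictly worse than `x` (`phi_lt_of_piece`), which together with `x` itself and the rows better than `x` are pairwise
distinct rows.  So a cell whose row and column are both in the worse halves is never a piece. [folklore] -/
theorem rank_add_rank_lt_card (hτ : 0 < τ) (hτ1 : τ < 1)
    (h : IsStrictTop ![-(1 - τ), -τ] (envPts φ ψ c) (envPt φ ψ c (x, y))) :
    (Finset.univ.filter fun x' => φ x' < φ x).card + (Finset.univ.filter fun y' => ψ y' < ψ y).card + 1 ≤
      Fintype.card G := by
  classical
  set B := Finset.univ.filter fun x' : G => φ x' < φ x with hB
  set Cy := Finset.univ.filter fun y' : G => ψ y' < ψ y with hCy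
  set W := Finset.univ.filter fun x' : G => φ x < φ x' with hW
  -- the injection of better columns into worse rows
  have hinj : Cy.card ≤ W.card := by
    refine Finset.card_le_card_of_injOn (fun y' => x + (y - y')) (fun y' hy' => ?_) ?_
    · have hy'' : ψ y' < ψ y := (Finset.mem_filter.1 (Finset.mem_coe.1 hy')).2
      exact Finset.mem_coe.2 (Finset.mem_filter.2 ⟨Finset.mem_univ _, phi_lt_of_piece hτ.le hτ1 h hy''⟩)
    · intro y₁ _ y₂ _ heq
      have : y - y₁ = y - y₂ := add_left_cancel heq
      exact sub_right_injective this
  -- `B`, `W` and `{x}` are pairwise disjoint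
  have hdisj : Disjoint B W := by
    rw [Finset.disjoint_filter]
    intro x' _ h1 h2
    exact lt_asymm h1 h2
  have hxB : x ∉ B ∪ W := by
    rw [Finset.mem_union, hB, hW, Finset.mem_filter, Finset.mem_filter]
    rintro (⟨-, h1⟩ | ⟨-, h1⟩) <;> exact lt_irrefl _ h1
  have hcard : (insert x (B ∪ W)).card = B.card + W.card + 1 := by
    rw [Finset.card_insert_of_notMem hxB, Finset.card_union_of_disjoint hdisj]
  calc B.card + Cy.card + 1 ≤ B.card + W.card + 1 := by omega
    _ = (insert x (B ∪ W)).card := hcard.symm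
    _ ≤ Fintype.card G := Finset.card_le_univ _

end Rank

/-! ### APPENDED (same seat): HOME LETTERS — a piece's row is at least as good as the "home row" -/

section Home

variable {G : Type*} [AddCommGroup G] [Fintype G]
variable {φ ψ c : G → ℝ} {x y : G} {τ : ℝ}

/-- The cost of a piece is at most the cost of ANY cell (equality allowed only for coincident points). [folklore] -/
theorem ecost_le_of_isStrictTop (h : IsStrictTop ![-(1 - τ), -τ] (envPts φ ψ c) (envPt φ ψ c (x, y))) (q : G × G) :
    ecost φ ψ c τ (x, y) ≤ ecost φ ψ c τ q := by
  by_cases hq : envPt φ ψ c q = envPt φ ψ c (x, y)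
  · have h1 := dot_envPt φ ψ c τ q
    rw [hq, dot_envPt] at h1
    linarith
  · exact (ecost_lt_of_isStrictTop h hq).le

/-- **Home row.**  If `(x, y)` is the strict minimiser at `τ > 0`, `y₀` minimises `ψ` and `x₁ + y₀` minimises `c`, then `φ x ≤ φ x₁`
(the piece's row is at least as good as the HOME ROW `x₁ = r_h - y₀` of memo §1; summed over the `|G|` classes of the rank-one model the
home rows are a permutation of `G`, so `∑_s #{admissible rows} = |G|(|G|+1)/2`). [folklore] -/
theorem phi_le_home (hτ : 0 < τ) (hτ1 : τ ≤ 1) (h : IsStrictTop ![-(1 - τ), -τ] (envPts φ ψ c) (envPt φ ψ c (x, y)))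
    {x₁ y₀ : G} (hy₀ : ∀ y', ψ y₀ ≤ ψ y') (hc : ∀ r, c (x₁ + y₀) ≤ c r) : φ x ≤ φ x₁ := by
  have h1 := ecost_le_of_isStrictTop h (x₁, y₀)
  simp only [ecost] at h1
  have h2 := hy₀ y
  have h3 := hc (x + y)
  have h1τ : 0 ≤ 1 - τ := by linarith
  have key : τ * φ x ≤ τ * φ x₁ := by nlinarith [mul_le_mul_of_nonneg_left h2 h1τ]
  exact le_of_mul_le_mul_left key hτ

/-- **Home column.**  Symmetrically at `τ < 1`: `ψ y ≤ ψ y₁` whenever `x₀` minimises `φ` and `x₀ + y₁` minimises `c`. [folklore] -/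
theorem psi_le_home (hτ : 0 ≤ τ) (hτ1 : τ < 1) (h : IsStrictTop ![-(1 - τ), -τ] (envPts φ ψ c) (envPt φ ψ c (x, y)))
    {x₀ y₁ : G} (hx₀ : ∀ x', φ x₀ ≤ φ x') (hc : ∀ r, c (x₀ + y₁) ≤ c r) : ψ y ≤ ψ y₁ := by
  have h1 := ecost_le_of_isStrictTop h (x₀, y₁)
  simp only [ecost] at h1
  have h2 := hx₀ x
  have h3 := hc (x + y)
  have h1τ : 0 < 1 - τ := by linarith
  have key : (1 - τ) * ψ y ≤ (1 - τ) * ψ y₁ := by nlinarith [mul_le_mul_of_nonneg_left h2 hτ]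
  exact le_of_mul_le_mul_left key h1τ

/-- **Home lift.**  At any `τ ∈ [0,1]`: `c (x + y) ≤ c (x₀ + y₀)` whenever `x₀` minimises `φ` and `y₀` minimises `ψ` (the piece's
anti-diagonal is at least as good as the corner cell's). [folklore] -/
theorem c_le_home (hτ : 0 ≤ τ) (hτ1 : τ ≤ 1) (h : IsStrictTop ![-(1 - τ), -τ] (envPts φ ψ c) (envPt φ ψ c (x, y)))
    {x₀ y₀ : G} (hx₀ : ∀ x', φ x₀ ≤ φ x') (hy₀ : ∀ y', ψ y₀ ≤ ψ y') : c (x + y) ≤ c (x₀ + y₀) := by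
  have h1 := ecost_le_of_isStrictTop h (x₀, y₀)
  simp only [ecost] at h1
  have h2 := hx₀ x
  have h3 := hy₀ y
  have h1τ : 0 ≤ 1 - τ := by linarith
  nlinarith [mul_le_mul_of_nonneg_left h2 hτ, mul_le_mul_of_nonneg_left h3 h1τ]

end Home

/-! ### APPENDED (same seat): TIME MONOTONICITY within a row / a column (memo §3 (P2)/(P3)) -/

section TimeOrder

variable {G : Type*} [AddCommGroup G] [Fintype G]
variable {φ ψ c : G → ℝ} {x y x' y' : G} {τ₁ τ₂ : ℝ}

/-- **(P2) Same row, later time ⇒ worse column and smaller lift.**  If `(x, y)` is the strict minimiser at `τ₁` and `(x, y')` at a later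
`τ₂ ∈ (τ₁, 1]` (distinct points), then `ψ y < ψ y'` and `c (x + y') < c (x + y)`. [folklore] -/
theorem row_later (hlt : τ₁ < τ₂) (hτ₂ : τ₂ ≤ 1) (h₁ : IsStrictTop ![-(1 - τ₁), -τ₁] (envPts φ ψ c) (envPt φ ψ c (x, y)))
    (h₂ : IsStrictTop ![-(1 - τ₂), -τ₂] (envPts φ ψ c) (envPt φ ψ c (x, y')))
    (hne : envPt φ ψ c (x, y') ≠ envPt φ ψ c (x, y)) : ψ y < ψ y' ∧ c (x + y') < c (x + y) := by
  have a := ecost_lt_of_isStrictTop h₁ hne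
  have b := ecost_lt_of_isStrictTop h₂ (Ne.symm hne)
  simp only [ecost] at a b
  have hψ : ψ y < ψ y' := by nlinarith
  refine ⟨hψ, ?_⟩
  have h2 : 0 ≤ 1 - τ₂ := by linarith
  nlinarith [mul_le_mul_of_nonneg_left hψ.le h2]

/-- **(P3) Same column, later time ⇒ better row and larger lift.**  If `(x, y)` is the strict minimiser at `τ₁` and `(x', y)` at a later
`τ₂ > τ₁ ≥ 0` (distinct points), then `φ x' < φ x` and `c (x + y) < c (x' + y)`. [folklore] -/
theorem col_later (hτ₁ : 0 ≤ τ₁) (hlt : τ₁ < τ₂) (h₁ : IsStrictTop ![-(1 - τ₁), -τ₁] (envPts φ ψ c) (envPt φ ψ c (x, y)))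
    (h₂ : IsStrictTop ![-(1 - τ₂), -τ₂] (envPts φ ψ c) (envPt φ ψ c (x', y)))
    (hne : envPt φ ψ c (x', y) ≠ envPt φ ψ c (x, y)) : φ x' < φ x ∧ c (x + y) < c (x' + y) := by
  have a := ecost_lt_of_isStrictTop h₁ hne
  have b := ecost_lt_of_isStrictTop h₂ (Ne.symm hne)
  simp only [ecost] at a b
  have hφ : φ x' < φ x := by nlinarith
  refine ⟨hφ, ?_⟩
  nlinarith [mul_le_mul_of_nonneg_left hφ.le hτ₁]

end TimeOrder

end TotalsLaw

end Summit.ValiantsHypothesis.ValiantsHypothesis.Theorems.NewtonUnitEquationsDissociatedUniform
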